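import Literature.Analysis.FluidPDE.LerayL3WeakStabilityThreeLeaves
import Literature.Analysis.FluidPDE.JiaSverak2013AprioriEstimateProofs
import Literature.Analysis.FluidPDE.LocalLerayLimitIdentification
import HarnessLib

/-!
# `localLeray_limiting_procedure_holds`: the limiting procedure for local Leray solutions
# (Jia–Šverák 2013, proof of Thm. 1) is now a theorem

Analysis/FluidPDE proof file (theorems only: no definitions, no named facts) **discharging** the
named fact `Literature.Analysis.FluidPDE.localLeray_limiting_procedure` (**F2** of
`JiaSverak2013Compactness.lean`: H. Jia, V. Šverák, SIAM J. Math. Anal. 45 (2013) =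
arXiv:1201.1592, proof of Thm. 1, p. 8, "By compactness as in Lemma 5, and weak continuity in `t`
we can find a subsequence of `u^k` … and a suitable weak solution `u` … `u` is a Leray solution
with initial data `u₀`"; Seregin 2014, App. B §B.4; Lemarié-Rieusset 2016, pp. 570–571) by the
one-liner recorded in the review `LerayL3WeakStabilityThreeLeaves.lean`:
`localLeray_limiting_procedure_of_two_leaves` (the accepted glue over Jia–Šverák's Lemma 2 and the
identification of the limit, with Rusin–Šverák's Prop. 2.2 proved) applied to the two discharges
`jia_sverak_2013_lemma_2_holds` (`JiaSverak2013AprioriEstimateProofs.lean`) and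
`localLeray_limit_isLocalLeraySolution_holds` (`LocalLerayLimitIdentification.lean`).

## Mathlib / tree search

`lean search 'localLeray_limiting_procedure_holds' --decl`: only the docstring of
`LerayL3WeakStabilityThreeLeaves.lean` (the recipe used here); the three ingredients are theorems
of the tree.

## References

* H. Jia, V. Šverák, SIAM J. Math. Anal. 45 (2013) = arXiv:1201.1592, Lemma 2, Lemma 5 and the
  proof of Thm. 1 (p. 8). [JiaSverak2013]
* W. Rusin, V. Šverák, J. Funct. Anal. 260 (2011) = arXiv:0911.0500, Prop. 2.2. [RusinSverak2011]
* G. Seregin, *Lecture Notes on Regularity Theory for the Navier–Stokes Equations* (2014),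
  App. B §B.4. [Seregin2014]
-/

namespace Literature.Analysis.FluidPDE

/-- **Discharge of `localLeray_limiting_procedure`** (Jia–Šverák 2013, proof of Thm. 1, p. 8:
compactness as in Lemma 5, weak continuity in `t`, identification of the limit as a Leray solution
with the weak-limit datum): the accepted glue `localLeray_limiting_procedure_of_two_leaves` fed
with `jia_sverak_2013_lemma_2_holds` and `localLeray_limit_isLocalLeraySolution_holds`.
[cite: JiaSverak2013, proof of Thm. 1 (arXiv:1201.1592 p. 8) with Lemma 2 and Lemma 5] -/
theorem localLeray_limiting_procedure_holds : localLeray_limiting_procedure :=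
  localLeray_limiting_procedure_of_two_leaves jia_sverak_2013_lemma_2_holds
    localLeray_limit_isLocalLeraySolution_holds

end Literature.Analysis.FluidPDE
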